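import Summits.BirchSwinnertonDyer.BirchSwinnertonDyer.Theorems.EisensteinPrimesMazurMCOnX1RankZero
import Summits.BirchSwinnertonDyer.Rank1Residual.WAll.AltClosersX1DeepWitness
import Literature.NumberTheory.EllipticCurves.Rank1Residual.ClassX1Isogeny

/-!
# Line `deepwitness` on crux `MazurMCOnX1RankZero` (item stmt-BirchSwinnertonDyer-19035, route `EisensteinPrimes`)

Cell `bsd-wall`, seat `bsd-wall-eis` g2; variant of line `shawitness` answering ty-2 g5 (p517824,
`AltClosersX1DeepWitness`): the MIN-DIGIT bet is removed.

LANGUAGE SWITCH (same as `shawitness`). Granted the refereed inputs (PUB), the crux is equivalent to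
`BSD(E,p)` at every rank-0 X1 pair (`mazurMCOnX1RankZero_iff_forall_bsdp`, k5-c5), and `BSD(E,p)` there is
decided by a FINITE certificate on ONE member `W'` of the Mazur class: `ord_p #Ш_an(W') ≤ 2k` together with a
subgroup of order `p^(2k-1)` inside `Ш(W')` (Kato–Wuthrich `#Ш ∣ #Ш_an` + Cassels–Tate alternation force
equality; ty-2's `x1RankZero_bsdp_of_deepWitness`). `k = 0`: unit certificate; `k = 1`: one non-zero element of
`Ш(W')[p]` = ONE p-isogeny descent (in hand for 113 of the 149 residue classes N < 5·10⁵, explicit and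
hand-checkable: HOME bsd-wall-eis/g2/X1-CERTS-EXPLICIT-v3.md); `k = 2`: a subgroup of order `p³` = a SECOND
isogeny descent (Creutz–Miller) on the ten `(2,4)` classes. RESIDUE-EXACT: `hdeep` is implied back by the leaf
(`deepWitness_of_x1RankZeroStatement`), so class-wide this stub is the crux in certificate currency — its teeth
are per cell (every instance is a finite computation), and Matsuno-type growth of `Ш[p]` in the class is harmless
(`k` adapts). Two stubs; composition `MazurMCOnX1RankZero_of` kernel-checked (no sorry outside `stub_*`).
-/

open WeierstrassCurve Literature.NumberTheory.EllipticCurves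
  Literature.NumberTheory.EllipticCurves.Rank1Residual Literature.NumberTheory.EllipticCurves.ModularForms

set_option linter.dupNamespace false
set_option autoImplicit false

namespace Summit.BirchSwinnertonDyer.BirchSwinnertonDyer.Cruxes.MazurMCOnX1RankZero.DeepWitness

/-- stub (PUB) — the refereed inputs BY NAME, one conjunction (as in line `shawitness`). -/
theorem stub_published :
    exists_casselsTate_pairing (K := ℚ) ∧ Wuthrich2014.sha_dvd_analyticSha ∧
      rank_eq_analyticRank_of_analyticRank_le_one ∧ hasEntireLFunction_rat ∧ bsdRHS_eq_of_isIsogenous ∧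
      Wuthrich2014.charIdeal_dvd_padicLFunction ∧ greenberg_charValue_rankZero ∧
      nonempty_modularParametrizationData := by
  sorry

/-- stub (DEEP Ш-WITNESS): in the Mazur class of a rank-0 X1 pair some minimal member `W'` has
`ord_p #Ш_an(W') ≤ 2k` and `p^(2k-1) ∣ #Ш(W')` for some `k` (per cell: `k` p-descents; 113/149 cells of the
N < 5·10⁵ residue certified at `k = 1`). -/
theorem stub_deepWitness : ∀ (W : WeierstrassCurve ℚ) [W.IsElliptic] [W.IsGloballyMinimal] (p : ℕ)
    [Fact p.Prime], ClassX1 W p → W.analyticRank = 0 →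
    ∃ (W' : WeierstrassCurve ℚ) (_ : W'.IsElliptic) (_ : W'.IsGloballyMinimal), IsIsogenous W W' ∧
      ∃ q : ℚ, shaAn W' = (q : ℂ) ∧ ∃ k : ℕ, padicValRat p q ≤ 2 * k ∧ p ^ (2 * k - 1) ∣ W'.shaOrder := by
  sorry

open Summit.BirchSwinnertonDyer.BirchSwinnertonDyer.Theorems.EisensteinPrimesMazurMCOnX1RankZero
  Summit.BirchSwinnertonDyer.Rank1Residual.WAll in
/-- **The line certificate.** `MazurMCOnX1RankZero` (fully-qualified route name) from the two stubs BY NAME: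
`BSD(E,p)` at every rank-0 X1 pair by ty-2's `x1RankZero_bsdp_of_deepWitness`, then k5-c5's converse chain
`mazurMCOnX1RankZero_iff_forall_bsdp`. Sorries live only inside `stub_*`. -/
theorem MazurMCOnX1RankZero_of :
    Summit.BirchSwinnertonDyer.BirchSwinnertonDyer.Theses.EisensteinPrimes.MazurMCOnX1RankZero := by
  have hP := stub_published
  obtain ⟨hCT, hSha, hGZK, hmod, hCas, hKW, hGr, hPar⟩ := hP
  exact (mazurMCOnX1RankZero_iff_forall_bsdp hKW hGr hPar hGZK).mpr
    (fun W _ _ p _ hX hr0 ↦ x1RankZero_bsdp_of_deepWitness hCT hSha hGZK hmod hCas stub_deepWitness W p hX hr0)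

end Summit.BirchSwinnertonDyer.BirchSwinnertonDyer.Cruxes.MazurMCOnX1RankZero.DeepWitness
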